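import Summits.MatrixMultiplication.OmegaCensus.STPPCell22Checker
import Summits.MatrixMultiplication.OmegaCensus.STPPCell22TablesA
import Summits.MatrixMultiplication.OmegaCensus.STPPCell22Tables

/-!
# ω-census (abelian STPP census): cell-(2,2) certificate of the fifth leaf `{(2,2,2),(3,3,3)²} @ ℤ₆₁` — stage 2 rows (realisations of the 40 placements)

HONEST FRAMING (pub-omega census; verbatim): lottery ticket; floor = certified bounds/negative ranges.
Census STRUCTURE (seat pub-omega-stpp-1 gen 33, 2026-08-29), family (b2).  KERNEL rows (`decide +kernel`) / glue for the checkers of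
`STPPCell22Checker.lean`; design and python ×1 DATUM in HOME `pub-omega-stpp-1-g33/FIFTH-LEAF.md`, generator `code/gen_cell22_rows.py`.
Nothing here is progress on `ω`.
-/

namespace Summit.MatrixMultiplication.OmegaCensus.CubeNB.S2

open Summit.MatrixMultiplication.OmegaCensus.CubeNB.Bits

/-- **Stage-2 row 1/4**: every realisation of the placements of part 1 is in the dead table. [folklore] -/
theorem plc22P1_real : (plc22P1.all (real22 61 zooNrm61 tbl22G)) = true := by decide +kernel

/-- **Stage-2 row 2/4**: every realisation of the placements of part 2 is in the dead table. [folklore] -/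
theorem plc22P2_real : (plc22P2.all (real22 61 zooNrm61 tbl22G)) = true := by decide +kernel

/-- **Stage-2 row 3/4**: every realisation of the placements of part 3 is in the dead table. [folklore] -/
theorem plc22P3_real : (plc22P3.all (real22 61 zooNrm61 tbl22G)) = true := by decide +kernel

/-- **Stage-2 row 4/4**: every realisation of the placements of part 4 is in the dead table. [folklore] -/
theorem plc22P4_real : (plc22P4.all (real22 61 zooNrm61 tbl22G)) = true := by decide +kernel

/-- **Stage 2**: every realisation `(Y°, Z°)` of every listed placement is in `tbl22G`. [folklore] -/
theorem plc22_real : (plc22.all (real22 61 zooNrm61 tbl22G)) = true := by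
  rw [plc22]
  simp only [List.all_append, Bool.and_eq_true]
  exact ⟨⟨⟨plc22P1_real, plc22P2_real⟩, plc22P3_real⟩, plc22P4_real⟩

/-- **Link row**: every pair of the grouped table occurs in the flat table. [folklore] -/
theorem tbl22G_sub : (tbl22G.all fun g => g.2.all fun z => tbl22F.any fun e => Nat.beq e.1 g.1 && Nat.beq e.2 z) = true := by decide +kernel

end Summit.MatrixMultiplication.OmegaCensus.CubeNB.S2
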